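import Summits.QuantumFields.YangMills.Theorems.BalabanUVNodesN18PolLimitsExistOfLocalTermsLocal

/-!
# BalabanUVNodes ∕ N18 (node U3's kernel objects) — W1-21's FINITE-VOLUME STABILISATION LETTER `GeometricIncrements` FROM THE LOCALIZED REPRESENTATION: the LOCAL truncation tail
# UNIFORMLY in the truncation radius (dag-n22-w2's resummation on the cast torus of record, run once per `K`), a two-scale real-analysis lemma (tails `C e^{−ηR}` + local stability
# increments `A e^{aR} ω^K` ⇒ geometric increments at `R = cK`), and `GeometricIncrements F (localizedSum F S emb) ρ bV W r` ∕ `GeometricIncrementsOfRecord₁₃ F N θ r` with an explicit `r < 1`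
# (Track A, DAG node N18 = NE5 ∕ node U3's letters; key K3⁸ `SpineGivenEndpointR13SepCoPHV` = stmt-QuantumFields-27366; cell `pub-ymgap`, WIDTH SEAT `pub-ymgap-dag-n18-w2` g9, FILE 7;
# `--kind proof --supports stmt-QuantumFields-27366 --as helper`, COUNT-NEUTRAL; THEOREMS ONLY, 0 `def`, 0 `sorry`)

WHY.  Node U3's (1.21) existence letter has TWO bills in the tree: the limit-letters bill displays `hL : PolLimitsExistOfRecord₁₃` (PART 1∕2 of `…N18PolLimitsExistOfLocalTerms{,Local}` now
produce it from the localized representation), the finite-volume bill (dag-n27-c `…CutFSCFiniteVolume`, dag-n27-w1) displays W1-21's `hinc : GeometricIncrementsOfRecord₁₃ F N θ (r F θ)` with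
`r < 1` ([I] (1.21) p. 264: the windowed kernels of consecutive volumes differ by `≤ C r^K`; consumers: dag-n22-w3 `polLimitExists_of_eventually_geometric_increments`, this seat's g6
`…N18PolLimitRateOfGeometricIncrements` — (1.21) WITH A RATE), which «has NO producer in the tree» (plan START-LIST v11 §n18).  THIS FILE is its producer from the same localized
representation: if the LOCAL truncated sums `S^{loc}_R(K)` (domains with `d(X) ≤ R` and `distCT(cast site 0, X) ≤ R`) not only converge but STABILISE GEOMETRICALLY —
`|S^{loc}_R(K+1) − S^{loc}_R(K)| ≤ A e^{aR} ω^K` from some `K_s` on, for every `R ≥ 0` (finitely many local terms, `∼ e^{aR}` of them, each stabilising at rate `ω` as the volume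
grows: the quantitative volume independence of the cluster expansion's local terms through the minimizer — DISPLAYED, NODE A ∕ N10 content) — then with the two-sided tail
`|Π^{(K)}(z) − S^{loc}_R(K)| ≤ C_t e^{−ηR}` (PART 2, `η = min{κ, δ₀}∕2`), UNIFORM in `R` for all large `K`, the choice `R := cK`, `c := −log ω ∕ (2(a+1))`, gives
`|Π^{(K+1)}(z) − Π^{(K)}(z)| ≤ (2C_t + A)·r^K`, `r := max{ω^{1∕2}, e^{−ηc}} < 1`.

WHAT.  §1 ★★ `eventually_forall_abs_polWindow_sub_localTruncated_le` (PART 2's tail bound with the quantifier order `∀ᶠ K, ∀ R ≥ 0` — dag-n22-w2's `le_softSum_resum` on the cast torus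
`(ℤ∕domCount·M)⁴` with the leaves `geomLeafT ∕ cubeSumLeafT ∕ treeLeafT` and the window isometry `hiso_cast`, whose eventual set does not depend on `R`).  §2 `abs_sub_le_geometric_of_twoScale`
(real analysis) · `twoScaleRate_lt_one`.  §3 ★★★ `geometricIncrements_localizedSum_of_localStabilityRate` (⇒ W1-21's `GeometricIncrements F (localizedSum F S emb) ρ bV W r`) ·
★★★ `geometricIncrementsOfRecord₁₃_of_localStabilityRate` (OF RECORD under W1-20's law, def-W1's `geometricIncrementsOfRecord₁₃_iff_of_localizes`).

HONEST FRAMING — what this is NOT.  Count-neutral bookkeeping (dag-n22-w2's resummation + elementary real analysis); NO estimate of Bałaban's is proved or asserted — the soft VALUE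
majorants ((1.18) + p. 282 ∕ (4.35)–(4.37) pp. 290–291) and the LOCAL STABILITY RATE (quantitative volume independence of the small near terms, [II] (2.13)–(2.14) through the minimizer
of [I] p. 264) are DISPLAYED hypotheses (NODE A ∕ N10 content); nothing constructed; no letter OF RECORD inhabited; N18 ∕ N22 ∕ (D4) NOT discharged; K3⁸ OPEN (v6), not claimed; counts
UNMOVED (typed 28∕28 · discharged 5∕27 (A 5∕28)); one finite four-torus programme at fixed ε, Bałaban AS PRINTED; R4 closes the conditional finite-𝕋⁴ rung `BalabanLadder.UV` only — NOT
ℝ⁴, NOT infinite volume, NOT OS, NOT a mass gap; the Clay problem is NOT proved by any of this.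

References (TYPES only): [I] = [Balaban1987RG1] (1.7) p. 261, (1.18) p. 263, (1.20)–(1.21) p. 264, p. 282, (4.35)–(4.36) p. 290, (4.37) p. 291, (5.10) p. 293; [II] = [Balaban1988RG2Cluster]
(2.13)–(2.14) pp. 14–15.  Imports PART 2 (through it PART 1, this seat's run-difference road, dag-n22-w2's three storeys, def-W1's files) BY NAME; nothing re-declared.
-/

noncomputable section

namespace YMDAG.N18.GeometricIncrementsOfLocalTerms

open Filter Metric
open scoped BigOperators Topology
open Literature.MathematicalPhysics.QuantumFieldTheory.Balaban1983to89
open Literature.MathematicalPhysics.QuantumFieldTheory.Balaban1983to89.T4Continuum (T4Family)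
open Literature.MathematicalPhysics.QuantumFieldTheory.Balaban1983to89.B12Sec2to5 (l1)
open Literature.MathematicalPhysics.QuantumFieldTheory.Balaban1983to89.B12PolarizationTensor120 (polComp expChart)
open Literature.MathematicalPhysics.QuantumFieldTheory.Balaban1983to89.Node00 (Stage13Params polScalar polWindow siteOfInt MatA)
open Literature.MathematicalPhysics.QuantumFieldTheory.Balaban1983to89.Node00.U3OfKernels (histPrefix)
open Literature.MathematicalPhysics.QuantumFieldTheory.Balaban1983to89.Node00.U3KernelLetters (GeometricIncrements GeometricIncrementsOfRecord₁₃ geometricIncrementsOfRecord₁₃_iff_of_localizes)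
open Literature.MathematicalPhysics.QuantumFieldTheory.Balaban1983to89.Node00.LocalizedSum17 (localizedSum ReadingMaps Localizes17OfRecord₁₃)
open Literature.MathematicalPhysics.QuantumFieldTheory.Balaban1983to89.Node00.Sect2 (domSys domCount)
open Literature.MathematicalPhysics.QuantumFieldTheory.Balaban1983to89.Node00.W1 (ClusterTower)
open Literature.MathematicalPhysics.QuantumFieldTheory.Balaban1983to89.T4OutputRate (Window)
open Literature.MathematicalPhysics.QuantumFieldTheory.Balaban1983to89.B12Decay510 (delta1 delta1_nonneg delta1_le_half delta1_mul_le)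
open Literature.MathematicalPhysics.QuantumFieldTheory.Balaban1983to89.B12Decay510Window (K₁)
open Literature.MathematicalPhysics.QuantumFieldTheory.Balaban1983to89.B12Decay510Torus (pl1 distCT nearT distCT_nonneg geomT geomLeafT cubeSumLeafT treeLeafT)
open Literature.MathematicalPhysics.QuantumFieldTheory.Balaban1983to89.B12TreeDecay (K₀ kappa₀ K₀_pos kappa₀_nonneg)
open Literature.MathematicalPhysics.QuantumFieldTheory.Balaban1983to89.TreeLengthTorus (TPt torusTreeLen torusTreeLen_nonneg)
open YMDAG.N22.WindowSoftTwoPoint (le_softSum_resum hiso_cast eventually_domCount_mul_dvd tendsto_domCount_mul)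
open YMDAG.N18.PolLimitsExistOfLocalTerms (polScalar_sum_eq_truncated_add_tail abs_polScalar_tail_le_sum_indicator exp_neg_mul_le_half_of_lt)

/-! ## §1 The LOCAL truncation tail, UNIFORMLY in the truncation radius, for all large `K` -/

section Tail

variable {𝔄 : Type*} [NormedRing 𝔄] [NormedAlgebra ℝ 𝔄] {V : Type*} [NormedAddCommGroup V] [NormedSpace ℝ V] {ι : Type*} [Fintype ι] {𝔸 : Type*}
variable (F : T4Family) (m' : ℕ) (M : ℕ) [NeZero M] (hM : M = F.L ^ m')
variable (S : (K : ℕ) → ClusterTower (F.P K) 𝔸 M) (emb : ReadingMaps F 𝔄 𝔸) (ρ : V →L[ℝ] 𝔄) (bV : Module.Basis ι ℝ V)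

include hM in
open Classical in
/-- ★★ **THE LOCAL TRUNCATION TAIL, UNIFORMLY IN `R`**: under the hypotheses of PART 2's `eventually_abs_polWindow_sub_localTruncated_le` (terms `C²`, K-uniform soft VALUE majorants at
`(κ, δ₀)`, `κ ≥ 0`, `δ₀ > 0`, `κ∕4 ≥ κ₀(64,8)`), FOR ALL LARGE `K` and then EVERY `R ≥ 0`:
`|Π^{(K)}_{k+1}(z) − S^{loc}_R(K)| ≤ C_E e^{12Mδ₁′}K₀(64,8)K₁(4,δ₀∕4)·e^{−ηR}·e^{−δ₁′|z|₁}`, `η = min{κ,δ₀}∕2`, `δ₁′ = ½min{δ₀∕2, (κ∕2)(4M)⁻¹}` — the eventual set (the window isometry of the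
cast torus and the divisibility `domCount·M ∣ sitesPerDir`) does not depend on `R`; the resummation is dag-n22-w2's `le_softSum_resum` on `(ℤ∕domCount·M)⁴` at the halved rates.
[cite: Balaban1987RG1, (1.7) p.261, (1.18) p.263, (1.20)-(1.21) p.264 and (5.10) p.293] -/
theorem eventually_forall_abs_polWindow_sub_localTruncated_le (k : ℕ) (hist : Fin (k + 1) → ℝ) (μ ν : Fin 4) (z : Fin 4 → ℤ)
    (hC : ∀ (K : ℕ) (X : (domSys (F.P K) M (k + 1)).Dom), ContDiffAt ℝ 2 (expChart (fun W => (((S K) k).E hist (emb K k W) X).re) ρ) 0)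
    {CE κ δ₀ : ℝ} (hCE : 0 ≤ CE) (hκ0 : 0 ≤ κ) (hδ₀ : 0 < δ₀) (hκ : kappa₀ (4 * 2 ^ 4) (2 * 4) ≤ κ / 2 / 2)
    (hval : ∀ (K : ℕ) (X : (domSys (F.P K) M (k + 1)).Dom) (c : ι),
      let e : Site (F.P K) (k + 1) → TPt 4 (domCount (F.P K) M (k + 1) * M) := fun x i => (ZMod.cast (x i) : ZMod (domCount (F.P K) M (k + 1) * M))
      |polComp ℝ (expChart (fun W => (((S K) k).E hist (emb K k W) X).re) ρ) bV (Fin.cast (F.P_d K).symm μ) (siteOfInt F K (k + 1) z) c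
          (Fin.cast (F.P_d K).symm ν) (siteOfInt F K (k + 1) 0) c| ≤
        CE * Real.exp (-κ * torusTreeLen X.1) * Real.exp (-δ₀ * distCT (domCount (F.P K) M (k + 1)) M (e (siteOfInt F K (k + 1) z)) (nearT (M := M) (e (siteOfInt F K (k + 1) z)) X)) *
          Real.exp (-δ₀ * distCT (domCount (F.P K) M (k + 1)) M (e (siteOfInt F K (k + 1) 0)) (nearT (M := M) (e (siteOfInt F K (k + 1) 0)) X))) :
    ∀ᶠ K in atTop, ∀ R : ℝ, 0 ≤ R →
      |polWindow F K (k + 1) (localizedSum F S emb k hist K) ρ bV μ ν z -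
          ∑ X ∈ Finset.univ.filter (fun X : (domSys (F.P K) M (k + 1)).Dom =>
              ¬ (R < torusTreeLen X.1 ∨ R < distCT (domCount (F.P K) M (k + 1)) M
                (fun i : Fin 4 => (ZMod.cast (siteOfInt F K (k + 1) 0 i) : ZMod (domCount (F.P K) M (k + 1) * M)))
                (nearT (M := M) (fun i : Fin 4 => (ZMod.cast (siteOfInt F K (k + 1) 0 i) : ZMod (domCount (F.P K) M (k + 1) * M))) X))),
            polScalar (fun W => (((S K) k).E hist (emb K k W) X).re) ρ bV (Fin.cast (F.P_d K).symm μ) (siteOfInt F K (k + 1) z) (Fin.cast (F.P_d K).symm ν)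
              (siteOfInt F K (k + 1) 0)| ≤
        CE * Real.exp (delta1 (δ₀ / 2) (κ / 2) ((M : ℝ) * 4) * ((M : ℝ) * 4) * 3) * K₀ (4 * 2 ^ 4) (2 * 4) * K₁ 4 (δ₀ / 2 / 2) * Real.exp (-(min κ δ₀ / 2) * R) *
          Real.exp (-(delta1 (δ₀ / 2) (κ / 2) ((M : ℝ) * 4) * l1 z)) := by
  subst hM
  have hηκ : min κ δ₀ / 2 ≤ κ / 2 := by have := min_le_left κ δ₀; linarith
  have hηδ : min κ δ₀ / 2 ≤ δ₀ / 2 := by have := min_le_right κ δ₀; linarith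
  have hκ'0 : 0 ≤ κ / 2 := by linarith
  have hhalf : ∀ {a x : ℝ}, 0 ≤ a → 0 ≤ x → Real.exp (-a * x) ≤ Real.exp (-(a / 2) * x) := fun ha hx =>
    Real.exp_le_exp.2 (by nlinarith)
  have hMd : (0 : ℝ) < ((F.L ^ m' : ℕ) : ℝ) * ((4 : ℕ) : ℝ) := mul_pos (Nat.cast_pos.2 (Nat.pos_of_neZero _)) (by norm_num)
  filter_upwards [hiso_cast F (k + 1) (fun K => domCount (F.P K) (F.L ^ m') (k + 1)) (F.L ^ m') (eventually_domCount_mul_dvd F (k + 1) m')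
    (tendsto_domCount_mul F (k + 1) m') z] with K hK
  intro R hR
  -- per-`K` Σ-shape at the cast window points written with the cast map's own binder
  have hd : ∀ X : (domSys (F.P K) (F.L ^ m') (k + 1)).Dom, 0 ≤ torusTreeLen X.1 := fun X => torusTreeLen_nonneg X.1
  have hΔ : |polWindow F K (k + 1) (localizedSum F S emb k hist K) ρ bV μ ν z -
      ∑ X ∈ Finset.univ.filter (fun X : (domSys (F.P K) (F.L ^ m') (k + 1)).Dom =>
          ¬ (R < torusTreeLen X.1 ∨ R < distCT (domCount (F.P K) (F.L ^ m') (k + 1)) (F.L ^ m')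
            (fun i : Fin 4 => (ZMod.cast (siteOfInt F K (k + 1) 0 i) : ZMod (domCount (F.P K) (F.L ^ m') (k + 1) * F.L ^ m')))
            (nearT (M := F.L ^ m') (fun i : Fin 4 => (ZMod.cast (siteOfInt F K (k + 1) 0 i) : ZMod (domCount (F.P K) (F.L ^ m') (k + 1) * F.L ^ m'))) X))),
        polScalar (fun W => (((S K) k).E hist (emb K k W) X).re) ρ bV (Fin.cast (F.P_d K).symm μ) (siteOfInt F K (k + 1) z) (Fin.cast (F.P_d K).symm ν)
          (siteOfInt F K (k + 1) 0)| ≤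
      ∑ X : (domSys (F.P K) (F.L ^ m') (k + 1)).Dom, (if (R < torusTreeLen X.1 ∨ R < distCT (domCount (F.P K) (F.L ^ m') (k + 1)) (F.L ^ m')
            (fun i : Fin 4 => (ZMod.cast (siteOfInt F K (k + 1) 0 i) : ZMod (domCount (F.P K) (F.L ^ m') (k + 1) * F.L ^ m')))
            (nearT (M := F.L ^ m') (fun i : Fin 4 => (ZMod.cast (siteOfInt F K (k + 1) 0 i) : ZMod (domCount (F.P K) (F.L ^ m') (k + 1) * F.L ^ m'))) X)) then
        CE * Real.exp (-κ * torusTreeLen X.1) *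
          Real.exp (-δ₀ * distCT (domCount (F.P K) (F.L ^ m') (k + 1)) (F.L ^ m')
            (fun i : Fin 4 => (ZMod.cast (siteOfInt F K (k + 1) z i) : ZMod (domCount (F.P K) (F.L ^ m') (k + 1) * F.L ^ m')))
            (nearT (M := F.L ^ m') (fun i : Fin 4 => (ZMod.cast (siteOfInt F K (k + 1) z i) : ZMod (domCount (F.P K) (F.L ^ m') (k + 1) * F.L ^ m'))) X)) *
          Real.exp (-δ₀ * distCT (domCount (F.P K) (F.L ^ m') (k + 1)) (F.L ^ m')
            (fun i : Fin 4 => (ZMod.cast (siteOfInt F K (k + 1) 0 i) : ZMod (domCount (F.P K) (F.L ^ m') (k + 1) * F.L ^ m')))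
            (nearT (M := F.L ^ m') (fun i : Fin 4 => (ZMod.cast (siteOfInt F K (k + 1) 0 i) : ZMod (domCount (F.P K) (F.L ^ m') (k + 1) * F.L ^ m'))) X)) else 0) := by
    have e1 : polWindow F K (k + 1) (localizedSum F S emb k hist K) ρ bV μ ν z =
        polScalar (fun U => ∑ X : (domSys (F.P K) (F.L ^ m') (k + 1)).Dom, (fun X W => (((S K) k).E hist (emb K k W) X).re) X U) ρ bV (Fin.cast (F.P_d K).symm μ)
          (siteOfInt F K (k + 1) z) (Fin.cast (F.P_d K).symm ν) (siteOfInt F K (k + 1) 0) := rfl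
    rw [e1, polScalar_sum_eq_truncated_add_tail _ ρ bV (hC K) (fun X : (domSys (F.P K) (F.L ^ m') (k + 1)).Dom =>
      R < torusTreeLen X.1 ∨ R < distCT (domCount (F.P K) (F.L ^ m') (k + 1)) (F.L ^ m')
        (fun i : Fin 4 => (ZMod.cast (siteOfInt F K (k + 1) 0 i) : ZMod (domCount (F.P K) (F.L ^ m') (k + 1) * F.L ^ m')))
        (nearT (M := F.L ^ m') (fun i : Fin 4 => (ZMod.cast (siteOfInt F K (k + 1) 0 i) : ZMod (domCount (F.P K) (F.L ^ m') (k + 1) * F.L ^ m'))) X)), add_sub_cancel_left]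
    exact abs_polScalar_tail_le_sum_indicator _ ρ bV (hC K) _ _
      (fun X => mul_nonneg (mul_nonneg (mul_nonneg hCE (Real.exp_pos _).le) (Real.exp_pos _).le) (Real.exp_pos _).le) _ _ _ _ (fun X _ c => hval K X c)
  -- the indicator-weighted majorants are soft majorants at `(κ∕2, δ₀∕2)` with weight `e^{−ηR}` in the cast geometry `geomT` (PART 2's case analysis)
  have h := le_softSum_resum (geomT 4 (domCount (F.P K) (F.L ^ m') (k + 1)) (F.L ^ m')) (dist := fun x y => pl1 (x - y))
    (CE := CE * Real.exp (-(min κ δ₀ / 2) * R)) (κ := κ / 2) (δ₀ := δ₀ / 2)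
    (mul_nonneg hCE (Real.exp_pos _).le) (K₀_pos _ _).le (delta1_nonneg (half_pos hδ₀).le hκ'0 hMd) (delta1_le_half (δ₀ / 2) (κ / 2) _) (delta1_mul_le (δ₀ / 2) (κ / 2) hMd)
    (geomLeafT 4 _ (F.L ^ m')) (cubeSumLeafT 4 _ (F.L ^ m') (half_pos (half_pos hδ₀))) (treeLeafT 4 _ hκ)
    (fun i : Fin (F.P K).d => (ZMod.cast (siteOfInt F K (k + 1) z i) : ZMod (domCount (F.P K) (F.L ^ m') (k + 1) * F.L ^ m')))
    (fun i : Fin (F.P K).d => (ZMod.cast (siteOfInt F K (k + 1) 0 i) : ZMod (domCount (F.P K) (F.L ^ m') (k + 1) * F.L ^ m'))) hΔ (fun X => ?_)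
  · -- the window isometry of the cast torus, restated on the cast points as written here (definitional), and the constant bookkeeping
    have hK' : pl1 (((fun i : Fin (F.P K).d => (ZMod.cast (siteOfInt F K (k + 1) z i) : ZMod (domCount (F.P K) (F.L ^ m') (k + 1) * F.L ^ m'))) :
          TPt 4 (domCount (F.P K) (F.L ^ m') (k + 1) * F.L ^ m')) -
        ((fun i : Fin (F.P K).d => (ZMod.cast (siteOfInt F K (k + 1) 0 i) : ZMod (domCount (F.P K) (F.L ^ m') (k + 1) * F.L ^ m'))) :
          TPt 4 (domCount (F.P K) (F.L ^ m') (k + 1) * F.L ^ m'))) = l1 z := hK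
    have key : CE * Real.exp (-(min κ δ₀ / 2) * R) * Real.exp (delta1 (δ₀ / 2) (κ / 2) (((F.L ^ m' : ℕ) : ℝ) * ((4 : ℕ) : ℝ)) * (((F.L ^ m' : ℕ) : ℝ) * ((4 : ℕ) : ℝ)) * 3) *
        K₀ (4 * 2 ^ 4) (2 * 4) * K₁ 4 (δ₀ / 2 / 2) *
        Real.exp (-delta1 (δ₀ / 2) (κ / 2) (((F.L ^ m' : ℕ) : ℝ) * ((4 : ℕ) : ℝ)) *
          pl1 (((fun i : Fin (F.P K).d => (ZMod.cast (siteOfInt F K (k + 1) z i) : ZMod (domCount (F.P K) (F.L ^ m') (k + 1) * F.L ^ m'))) :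
              TPt 4 (domCount (F.P K) (F.L ^ m') (k + 1) * F.L ^ m')) -
            ((fun i : Fin (F.P K).d => (ZMod.cast (siteOfInt F K (k + 1) 0 i) : ZMod (domCount (F.P K) (F.L ^ m') (k + 1) * F.L ^ m'))) :
              TPt 4 (domCount (F.P K) (F.L ^ m') (k + 1) * F.L ^ m')))) =
      CE * Real.exp (delta1 (δ₀ / 2) (κ / 2) (((F.L ^ m' : ℕ) : ℝ) * 4) * (((F.L ^ m' : ℕ) : ℝ) * 4) * 3) * K₀ (4 * 2 ^ 4) (2 * 4) * K₁ 4 (δ₀ / 2 / 2) *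
        Real.exp (-(min κ δ₀ / 2) * R) * Real.exp (-(delta1 (δ₀ / 2) (κ / 2) (((F.L ^ m' : ℕ) : ℝ) * 4) * l1 z)) := by
      rw [hK']
      simp only [Nat.cast_ofNat]
      ring
    exact le_trans h key.le
  · -- the majorant for one domain `X` (cases: kept ∕ `d(X) > R` ∕ `dist > R`)
    show _ ≤ CE * Real.exp (-(min κ δ₀ / 2) * R) * Real.exp (-(κ / 2) * torusTreeLen X.1) *
      Real.exp (-(δ₀ / 2) * distCT (domCount (F.P K) (F.L ^ m') (k + 1)) (F.L ^ m')
        (fun i : Fin 4 => (ZMod.cast (siteOfInt F K (k + 1) z i) : ZMod (domCount (F.P K) (F.L ^ m') (k + 1) * F.L ^ m')))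
        (nearT (M := F.L ^ m') (fun i : Fin 4 => (ZMod.cast (siteOfInt F K (k + 1) z i) : ZMod (domCount (F.P K) (F.L ^ m') (k + 1) * F.L ^ m'))) X)) *
      Real.exp (-(δ₀ / 2) * distCT (domCount (F.P K) (F.L ^ m') (k + 1)) (F.L ^ m')
        (fun i : Fin 4 => (ZMod.cast (siteOfInt F K (k + 1) 0 i) : ZMod (domCount (F.P K) (F.L ^ m') (k + 1) * F.L ^ m')))
        (nearT (M := F.L ^ m') (fun i : Fin 4 => (ZMod.cast (siteOfInt F K (k + 1) 0 i) : ZMod (domCount (F.P K) (F.L ^ m') (k + 1) * F.L ^ m'))) X))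
    have hdz := distCT_nonneg (N := domCount (F.P K) (F.L ^ m') (k + 1)) (M := F.L ^ m')
      (fun i : Fin 4 => (ZMod.cast (siteOfInt F K (k + 1) z i) : ZMod (domCount (F.P K) (F.L ^ m') (k + 1) * F.L ^ m')))
      (nearT (M := F.L ^ m') (fun i : Fin 4 => (ZMod.cast (siteOfInt F K (k + 1) z i) : ZMod (domCount (F.P K) (F.L ^ m') (k + 1) * F.L ^ m'))) X)
    have hd00 := distCT_nonneg (N := domCount (F.P K) (F.L ^ m') (k + 1)) (M := F.L ^ m')
      (fun i : Fin 4 => (ZMod.cast (siteOfInt F K (k + 1) 0 i) : ZMod (domCount (F.P K) (F.L ^ m') (k + 1) * F.L ^ m')))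
      (nearT (M := F.L ^ m') (fun i : Fin 4 => (ZMod.cast (siteOfInt F K (k + 1) 0 i) : ZMod (domCount (F.P K) (F.L ^ m') (k + 1) * F.L ^ m'))) X)
    split_ifs with hp
    · rcases hp with hRd | hRdist
      · have h1 := exp_neg_mul_le_half_of_lt hκ0 hR hRd hηκ
        have h2 := hhalf hδ₀.le hdz
        have h3 := hhalf hδ₀.le hd00
        calc _ ≤ CE * (Real.exp (-(min κ δ₀ / 2) * R) * Real.exp (-(κ / 2) * torusTreeLen X.1)) * Real.exp (-(δ₀ / 2) * _) * Real.exp (-(δ₀ / 2) * _) :=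
            mul_le_mul (mul_le_mul (mul_le_mul_of_nonneg_left h1 hCE) h2 (Real.exp_pos _).le (mul_nonneg hCE (mul_nonneg (Real.exp_pos _).le (Real.exp_pos _).le)))
              h3 (Real.exp_pos _).le (mul_nonneg (mul_nonneg hCE (mul_nonneg (Real.exp_pos _).le (Real.exp_pos _).le)) (Real.exp_pos _).le)
          _ = _ := by ring
      · have h1 := hhalf hκ0 (hd X)
        have h2 := hhalf hδ₀.le hdz
        have h3 := exp_neg_mul_le_half_of_lt hδ₀.le hR hRdist hηδ
        calc _ ≤ CE * Real.exp (-(κ / 2) * torusTreeLen X.1) * Real.exp (-(δ₀ / 2) * _) * (Real.exp (-(min κ δ₀ / 2) * R) * Real.exp (-(δ₀ / 2) * _)) :=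
            mul_le_mul (mul_le_mul (mul_le_mul_of_nonneg_left h1 hCE) h2 (Real.exp_pos _).le (mul_nonneg hCE (Real.exp_pos _).le))
              h3 (Real.exp_pos _).le (mul_nonneg (mul_nonneg hCE (Real.exp_pos _).le) (Real.exp_pos _).le)
          _ = _ := by ring
    · exact mul_nonneg (mul_nonneg (mul_nonneg (mul_nonneg hCE (Real.exp_pos _).le) (Real.exp_pos _).le) (Real.exp_pos _).le) (Real.exp_pos _).le

end Tail

/-! ## §2 Real analysis: two scales ⇒ geometric increments -/

/-- **TWO SCALES ⇒ GEOMETRIC INCREMENTS**: if a sequence `u` is `C_t e^{−ηR}`-close to `s_R` for all `K ≥ K₁` and all `R ≥ 0` (`η > 0`), and each `s_R` has increments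
`≤ A e^{aR} ω^K` from `K₁` on (`0 < ω < 1`, `a ≥ 0`), then with `c := −log ω ∕ (2(a+1))` and `r := max{e^{(log ω)∕2}, e^{−ηc}}`, for all `K ≥ K₁`:
`|u(K+1) − u(K)| ≤ (2C_t + A)·r^K` (take `R := cK`: `e^{acK}ω^K ≤ ω^{K∕2}` since `a∕(a+1) ≤ 1`). [folklore] -/
theorem abs_sub_le_geometric_of_twoScale {u : ℕ → ℝ} {s : ℝ → ℕ → ℝ} {K₁ : ℕ} {Ct η A a ω : ℝ} (hCt : 0 ≤ Ct) (hA : 0 ≤ A) (ha : 0 ≤ a)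
    (hω : 0 < ω) (hω1 : ω < 1)
    (htail : ∀ K, K₁ ≤ K → ∀ R : ℝ, 0 ≤ R → |u K - s R K| ≤ Ct * Real.exp (-η * R))
    (hstab : ∀ R : ℝ, 0 ≤ R → ∀ K, K₁ ≤ K → |s R (K + 1) - s R K| ≤ A * Real.exp (a * R) * ω ^ K) (K : ℕ) (hK : K₁ ≤ K) :
    |u (K + 1) - u K| ≤ (2 * Ct + A) * (max (Real.exp (Real.log ω / 2)) (Real.exp (-η * (-Real.log ω / (2 * (a + 1)))))) ^ K := by
  have hlog : Real.log ω < 0 := Real.log_neg hω hω1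
  set c : ℝ := -Real.log ω / (2 * (a + 1)) with hc
  have hc0 : 0 < c := by rw [hc]; exact div_pos (by linarith) (by linarith)
  set r₁ : ℝ := Real.exp (Real.log ω / 2) with hr₁
  set r₂ : ℝ := Real.exp (-η * c) with hr₂
  have hR0 : 0 ≤ c * K := mul_nonneg hc0.le (Nat.cast_nonneg K)
  -- the three pieces at `R := cK`
  have h1 := htail (K + 1) (le_trans hK (Nat.le_succ K)) (c * K) hR0
  have h2 := hstab (c * K) hR0 K hK
  have h3 := htail K hK (c * K) hR0
  -- `e^{−η c K} = r₂^K`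
  have e2 : Real.exp (-η * (c * K)) = r₂ ^ K := by
    rw [hr₂, ← Real.exp_nat_mul]; congr 1; ring
  -- `e^{a c K} ω^K ≤ r₁^K`
  have e1 : Real.exp (a * (c * K)) * ω ^ K ≤ r₁ ^ K := by
    have hωK : ω ^ K = Real.exp (K * Real.log ω) := by rw [Real.exp_nat_mul, Real.exp_log hω]
    rw [hωK, ← Real.exp_add, hr₁, ← Real.exp_nat_mul]
    refine Real.exp_le_exp.2 ?_
    -- `a c + log ω ≤ (log ω)∕2`
    have hac : a * c ≤ -Real.log ω / 2 := by
      rw [hc, show a * (-Real.log ω / (2 * (a + 1))) = (-Real.log ω / 2) * (a / (a + 1)) by field_simp]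
      have : a / (a + 1) ≤ 1 := (div_le_one (by linarith)).2 (by linarith)
      have h0 : 0 ≤ -Real.log ω / 2 := by linarith
      nlinarith
    have hK0 : (0 : ℝ) ≤ K := Nat.cast_nonneg K
    nlinarith
  have hr₁r : r₁ ^ K ≤ (max r₁ r₂) ^ K := pow_le_pow_left₀ (Real.exp_pos _).le (le_max_left _ _) K
  have hr₂r : r₂ ^ K ≤ (max r₁ r₂) ^ K := pow_le_pow_left₀ (Real.exp_pos _).le (le_max_right _ _) K
  calc |u (K + 1) - u K| = |(u (K + 1) - s (c * K) (K + 1)) + (s (c * K) (K + 1) - s (c * K) K) + (s (c * K) K - u K)| := by ring_nf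
    _ ≤ |u (K + 1) - s (c * K) (K + 1)| + |s (c * K) (K + 1) - s (c * K) K| + |s (c * K) K - u K| :=
        (abs_add_le _ _).trans (add_le_add (abs_add_le _ _) le_rfl)
    _ ≤ Ct * Real.exp (-η * (c * K)) + A * Real.exp (a * (c * K)) * ω ^ K + Ct * Real.exp (-η * (c * K)) := by
        rw [abs_sub_comm (s (c * K) K) (u K)]; exact add_le_add (add_le_add h1 h2) h3
    _ ≤ Ct * (max r₁ r₂) ^ K + A * (max r₁ r₂) ^ K + Ct * (max r₁ r₂) ^ K := by
        rw [e2, mul_assoc]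
        exact add_le_add (add_le_add (mul_le_mul_of_nonneg_left hr₂r hCt) (mul_le_mul_of_nonneg_left (e1.trans hr₁r) hA))
          (mul_le_mul_of_nonneg_left hr₂r hCt)
    _ = (2 * Ct + A) * (max r₁ r₂) ^ K := by ring

/-- The two-scale rate is `< 1` (`0 < ω < 1`, `η > 0`, `a ≥ 0`). [folklore] -/
theorem twoScaleRate_lt_one {η a ω : ℝ} (hη : 0 < η) (ha : 0 ≤ a) (hω : 0 < ω) (hω1 : ω < 1) :
    max (Real.exp (Real.log ω / 2)) (Real.exp (-η * (-Real.log ω / (2 * (a + 1))))) < 1 := by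
  have hlog : Real.log ω < 0 := Real.log_neg hω hω1
  refine max_lt (Real.exp_lt_one_iff.2 (by linarith)) (Real.exp_lt_one_iff.2 ?_)
  have hc : 0 < -Real.log ω / (2 * (a + 1)) := div_pos (by linarith) (by linarith)
  nlinarith

/-- The two-scale rate is nonnegative. [folklore] -/
theorem twoScaleRate_nonneg (η a ω : ℝ) : 0 ≤ max (Real.exp (Real.log ω / 2)) (Real.exp (-η * (-Real.log ω / (2 * (a + 1))))) :=
  (Real.exp_pos _).le.trans (le_max_left _ _)

/-! ## §3 W1-21's `GeometricIncrements` for the localized sum, and OF RECORD -/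

section Letter

variable {𝔄 : Type*} [NormedRing 𝔄] [NormedAlgebra ℝ 𝔄] {V : Type*} [NormedAddCommGroup V] [NormedSpace ℝ V] {ι : Type*} [Fintype ι] {𝔸 : Type*}
variable (F : T4Family) (m' : ℕ) (M : ℕ) [NeZero M] (hM : M = F.L ^ m')
variable (S : (K : ℕ) → ClusterTower (F.P K) 𝔸 M) (emb : ReadingMaps F 𝔄 𝔸) (ρ : V →L[ℝ] 𝔄) (bV : Module.Basis ι ℝ V)

include hM in
open Classical in
/-- ★★★ **W1-21's FINITE-VOLUME STABILISATION LETTER FROM THE LOCALIZED REPRESENTATION**: for W1-20's `localizedSum F S emb` on a window `W`: the terms' `C²` charts, K-uniform soft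
VALUE majorants at `(κ, δ₀)` (`C_E` may depend on `(g, k, μ, ν, z)`; `κ, δ₀ > 0`, `κ∕4 ≥ κ₀(64,8)`), and the LOCAL STABILITY RATE «from some `K_s` on, every local truncated sum has
increments `|S^{loc}_R(K+1) − S^{loc}_R(K)| ≤ A e^{aR} ω^K`, all `R ≥ 0`» (`A, K_s` may depend on `(g, k, μ, ν, z)`; `a ≥ 0` and `0 < ω < 1` uniform — DISPLAYED) ⇒
`GeometricIncrements F (localizedSum F S emb) ρ bV W r` with the uniform ratio `r = max{ω^{1∕2}, e^{−ηc}} < 1`, `η = min{κ,δ₀}∕2`, `c = −log ω∕(2(a+1))` (`twoScaleRate_lt_one`).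
[cite: Balaban1987RG1, (1.7) p.261 and (1.20)-(1.21) p.264; Balaban1988RG2Cluster, (2.13)-(2.14) pp.14-15] -/
theorem geometricIncrements_localizedSum_of_localStabilityRate (W : Set (ℕ → ℝ)) {κ δ₀ a ω : ℝ} (hκ0 : 0 < κ) (hδ₀ : 0 < δ₀)
    (hκ : kappa₀ (4 * 2 ^ 4) (2 * 4) ≤ κ / 2 / 2) (ha : 0 ≤ a) (hω : 0 < ω) (hω1 : ω < 1)
    (hC : ∀ g ∈ W, ∀ (k K : ℕ) (X : (domSys (F.P K) M (k + 1)).Dom), ContDiffAt ℝ 2 (expChart (fun W' => (((S K) k).E (histPrefix g k) (emb K k W') X).re) ρ) 0)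
    (hval : ∀ g ∈ W, ∀ (k : ℕ) (μ ν : Fin 4) (z : Fin 4 → ℤ), ∃ CE : ℝ, 0 ≤ CE ∧ ∀ (K : ℕ) (X : (domSys (F.P K) M (k + 1)).Dom) (c : ι),
      let e : Site (F.P K) (k + 1) → TPt 4 (domCount (F.P K) M (k + 1) * M) := fun x i => (ZMod.cast (x i) : ZMod (domCount (F.P K) M (k + 1) * M))
      |polComp ℝ (expChart (fun W' => (((S K) k).E (histPrefix g k) (emb K k W') X).re) ρ) bV (Fin.cast (F.P_d K).symm μ) (siteOfInt F K (k + 1) z) c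
          (Fin.cast (F.P_d K).symm ν) (siteOfInt F K (k + 1) 0) c| ≤
        CE * Real.exp (-κ * torusTreeLen X.1) * Real.exp (-δ₀ * distCT (domCount (F.P K) M (k + 1)) M (e (siteOfInt F K (k + 1) z)) (nearT (M := M) (e (siteOfInt F K (k + 1) z)) X)) *
          Real.exp (-δ₀ * distCT (domCount (F.P K) M (k + 1)) M (e (siteOfInt F K (k + 1) 0)) (nearT (M := M) (e (siteOfInt F K (k + 1) 0)) X)))
    (hstab : ∀ g ∈ W, ∀ (k : ℕ) (μ ν : Fin 4) (z : Fin 4 → ℤ), ∃ (Ks : ℕ) (A : ℝ), 0 ≤ A ∧ ∀ R : ℝ, 0 ≤ R → ∀ K, Ks ≤ K →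
      |(∑ X ∈ Finset.univ.filter (fun X : (domSys (F.P (K + 1)) M (k + 1)).Dom =>
          ¬ (R < torusTreeLen X.1 ∨ R < distCT (domCount (F.P (K + 1)) M (k + 1)) M
            (fun i : Fin 4 => (ZMod.cast (siteOfInt F (K + 1) (k + 1) 0 i) : ZMod (domCount (F.P (K + 1)) M (k + 1) * M)))
            (nearT (M := M) (fun i : Fin 4 => (ZMod.cast (siteOfInt F (K + 1) (k + 1) 0 i) : ZMod (domCount (F.P (K + 1)) M (k + 1) * M))) X))),
          polScalar (fun W' => (((S (K + 1)) k).E (histPrefix g k) (emb (K + 1) k W') X).re) ρ bV (Fin.cast (F.P_d (K + 1)).symm μ) (siteOfInt F (K + 1) (k + 1) z)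
            (Fin.cast (F.P_d (K + 1)).symm ν) (siteOfInt F (K + 1) (k + 1) 0)) -
        (∑ X ∈ Finset.univ.filter (fun X : (domSys (F.P K) M (k + 1)).Dom =>
          ¬ (R < torusTreeLen X.1 ∨ R < distCT (domCount (F.P K) M (k + 1)) M
            (fun i : Fin 4 => (ZMod.cast (siteOfInt F K (k + 1) 0 i) : ZMod (domCount (F.P K) M (k + 1) * M)))
            (nearT (M := M) (fun i : Fin 4 => (ZMod.cast (siteOfInt F K (k + 1) 0 i) : ZMod (domCount (F.P K) M (k + 1) * M))) X))),
          polScalar (fun W' => (((S K) k).E (histPrefix g k) (emb K k W') X).re) ρ bV (Fin.cast (F.P_d K).symm μ) (siteOfInt F K (k + 1) z)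
            (Fin.cast (F.P_d K).symm ν) (siteOfInt F K (k + 1) 0))| ≤ A * Real.exp (a * R) * ω ^ K) :
    GeometricIncrements F (localizedSum F S emb) ρ bV W (max (Real.exp (Real.log ω / 2)) (Real.exp (-(min κ δ₀ / 2) * (-Real.log ω / (2 * (a + 1)))))) := by
  intro g hg k μ ν z
  obtain ⟨CE, hCE, hv⟩ := hval g hg k μ ν z
  obtain ⟨Ks, A, hA, hs⟩ := hstab g hg k μ ν z
  obtain ⟨Kt, hKt⟩ := eventually_atTop.1 (eventually_forall_abs_polWindow_sub_localTruncated_le F m' M hM S emb ρ bV k (histPrefix g k) μ ν z (hC g hg k) hCE hκ0.le hδ₀ hκ hv)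
  set Ct : ℝ := CE * Real.exp (delta1 (δ₀ / 2) (κ / 2) ((M : ℝ) * 4) * ((M : ℝ) * 4) * 3) * K₀ (4 * 2 ^ 4) (2 * 4) * K₁ 4 (δ₀ / 2 / 2) *
    Real.exp (-(delta1 (δ₀ / 2) (κ / 2) ((M : ℝ) * 4) * l1 z)) with hCt
  have hCt0 : 0 ≤ Ct := by
    rw [hCt]
    have hK1 : 0 ≤ K₁ 4 (δ₀ / 2 / 2) := B12Decay510Window.K₁_nonneg 4 (δ₀ / 2 / 2)
    exact mul_nonneg (mul_nonneg (mul_nonneg (mul_nonneg hCE (Real.exp_pos _).le) (K₀_pos _ _).le) hK1) (Real.exp_pos _).le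
  refine ⟨max Kt Ks, 2 * Ct + A, fun K hK => ?_⟩
  exact abs_sub_le_geometric_of_twoScale (u := fun K => polWindow F K (k + 1) (localizedSum F S emb k (histPrefix g k) K) ρ bV μ ν z)
    (s := fun R K => ∑ X ∈ Finset.univ.filter (fun X : (domSys (F.P K) M (k + 1)).Dom =>
        ¬ (R < torusTreeLen X.1 ∨ R < distCT (domCount (F.P K) M (k + 1)) M
          (fun i : Fin 4 => (ZMod.cast (siteOfInt F K (k + 1) 0 i) : ZMod (domCount (F.P K) M (k + 1) * M)))
          (nearT (M := M) (fun i : Fin 4 => (ZMod.cast (siteOfInt F K (k + 1) 0 i) : ZMod (domCount (F.P K) M (k + 1) * M))) X))),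
        polScalar (fun W' => (((S K) k).E (histPrefix g k) (emb K k W') X).re) ρ bV (Fin.cast (F.P_d K).symm μ) (siteOfInt F K (k + 1) z)
          (Fin.cast (F.P_d K).symm ν) (siteOfInt F K (k + 1) 0))
    (K₁ := max Kt Ks) hCt0 hA ha hω hω1 (fun K' hK' R hR => (hKt K' (le_of_max_le_left hK') R hR).trans (le_of_eq (by rw [hCt]; ring)))
    (fun R hR K' hK' => hs R hR K' (le_of_max_le_right hK')) K hK

end Letter

section Record

open scoped Matrix.Norms.L2Operator

variable {𝔸 : Type*} (F : T4Family) (N : ℕ) [NeZero N] (m' : ℕ) (M : ℕ) [NeZero M] (hM : M = F.L ^ m')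

include hM in
open Classical in
/-- ★★★ **W1-21's LETTER OF RECORD `GeometricIncrementsOfRecord₁₃ F N θ r` FROM THE LOCALIZED REPRESENTATION** (the `hinc` row of the finite-volume bills, `r < 1` by
`twoScaleRate_lt_one`): under W1-20's law `Localizes17OfRecord₁₃ F N θ S emb`, the terms' `C²` charts in the record's β-chart, K-uniform soft value majorants and the local stability
rate ⇒ `GeometricIncrementsOfRecord₁₃ F N θ (max{ω^{1∕2}, e^{−ηc}})` (def-W1's `geometricIncrementsOfRecord₁₃_iff_of_localizes`). [cite: Balaban1987RG1, (1.7) p.261 and (1.21) p.264; Balaban1988RG2Cluster, (2.14) p.15] -/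
theorem geometricIncrementsOfRecord₁₃_of_localStabilityRate (θ : Stage13Params F N) (S : (K : ℕ) → ClusterTower (F.P K) 𝔸 M) (emb : ReadingMaps F (MatA N) 𝔸)
    (hloc : Localizes17OfRecord₁₃ F N θ S emb) {κ δ₀ a ω : ℝ} (hκ0 : 0 < κ) (hδ₀ : 0 < δ₀) (hκ : kappa₀ (4 * 2 ^ 4) (2 * 4) ≤ κ / 2 / 2) (ha : 0 ≤ a)
    (hω : 0 < ω) (hω1 : ω < 1)
    (hC : letI := θ.instVβ₁; letI := θ.instVβ₂
      ∀ g ∈ Window θ.γ, ∀ (k K : ℕ) (X : (domSys (F.P K) M (k + 1)).Dom),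
        ContDiffAt ℝ 2 (expChart (fun W' => (((S K) k).E (histPrefix g k) (emb K k W') X).re) θ.ρ8) 0)
    (hval : letI := θ.instVβ₁; letI := θ.instVβ₂; letI := θ.instιβ
      ∀ g ∈ Window θ.γ, ∀ (k : ℕ) (μ ν : Fin 4) (z : Fin 4 → ℤ), ∃ CE : ℝ, 0 ≤ CE ∧ ∀ (K : ℕ) (X : (domSys (F.P K) M (k + 1)).Dom) (c : θ.ιβ),
        let e : Site (F.P K) (k + 1) → TPt 4 (domCount (F.P K) M (k + 1) * M) := fun x i => (ZMod.cast (x i) : ZMod (domCount (F.P K) M (k + 1) * M))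
        |polComp ℝ (expChart (fun W' => (((S K) k).E (histPrefix g k) (emb K k W') X).re) θ.ρ8) θ.bV (Fin.cast (F.P_d K).symm μ) (siteOfInt F K (k + 1) z) c
            (Fin.cast (F.P_d K).symm ν) (siteOfInt F K (k + 1) 0) c| ≤
          CE * Real.exp (-κ * torusTreeLen X.1) * Real.exp (-δ₀ * distCT (domCount (F.P K) M (k + 1)) M (e (siteOfInt F K (k + 1) z)) (nearT (M := M) (e (siteOfInt F K (k + 1) z)) X)) *
            Real.exp (-δ₀ * distCT (domCount (F.P K) M (k + 1)) M (e (siteOfInt F K (k + 1) 0)) (nearT (M := M) (e (siteOfInt F K (k + 1) 0)) X)))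
    (hstab : letI := θ.instVβ₁; letI := θ.instVβ₂; letI := θ.instιβ
      ∀ g ∈ Window θ.γ, ∀ (k : ℕ) (μ ν : Fin 4) (z : Fin 4 → ℤ), ∃ (Ks : ℕ) (A : ℝ), 0 ≤ A ∧ ∀ R : ℝ, 0 ≤ R → ∀ K, Ks ≤ K →
        |(∑ X ∈ Finset.univ.filter (fun X : (domSys (F.P (K + 1)) M (k + 1)).Dom =>
            ¬ (R < torusTreeLen X.1 ∨ R < distCT (domCount (F.P (K + 1)) M (k + 1)) M
              (fun i : Fin 4 => (ZMod.cast (siteOfInt F (K + 1) (k + 1) 0 i) : ZMod (domCount (F.P (K + 1)) M (k + 1) * M)))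
              (nearT (M := M) (fun i : Fin 4 => (ZMod.cast (siteOfInt F (K + 1) (k + 1) 0 i) : ZMod (domCount (F.P (K + 1)) M (k + 1) * M))) X))),
            polScalar (fun W' => (((S (K + 1)) k).E (histPrefix g k) (emb (K + 1) k W') X).re) θ.ρ8 θ.bV (Fin.cast (F.P_d (K + 1)).symm μ) (siteOfInt F (K + 1) (k + 1) z)
              (Fin.cast (F.P_d (K + 1)).symm ν) (siteOfInt F (K + 1) (k + 1) 0)) -
          (∑ X ∈ Finset.univ.filter (fun X : (domSys (F.P K) M (k + 1)).Dom =>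
            ¬ (R < torusTreeLen X.1 ∨ R < distCT (domCount (F.P K) M (k + 1)) M
              (fun i : Fin 4 => (ZMod.cast (siteOfInt F K (k + 1) 0 i) : ZMod (domCount (F.P K) M (k + 1) * M)))
              (nearT (M := M) (fun i : Fin 4 => (ZMod.cast (siteOfInt F K (k + 1) 0 i) : ZMod (domCount (F.P K) M (k + 1) * M))) X))),
            polScalar (fun W' => (((S K) k).E (histPrefix g k) (emb K k W') X).re) θ.ρ8 θ.bV (Fin.cast (F.P_d K).symm μ) (siteOfInt F K (k + 1) z)
              (Fin.cast (F.P_d K).symm ν) (siteOfInt F K (k + 1) 0))| ≤ A * Real.exp (a * R) * ω ^ K) :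
    GeometricIncrementsOfRecord₁₃ F N θ (max (Real.exp (Real.log ω / 2)) (Real.exp (-(min κ δ₀ / 2) * (-Real.log ω / (2 * (a + 1)))))) := by
  letI := θ.instVβ₁; letI := θ.instVβ₂; letI := θ.instιβ
  exact (geometricIncrementsOfRecord₁₃_iff_of_localizes F N θ S emb hloc _).2
    (geometricIncrements_localizedSum_of_localStabilityRate F m' M hM S emb θ.ρ8 θ.bV (Window θ.γ) hκ0 hδ₀ hκ ha hω hω1 hC hval hstab)

end Record

end YMDAG.N18.GeometricIncrementsOfLocalTerms

end
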